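import Mathlib
import Literature.NumberTheory.Transcendental.ZagierDilogarithmConjecture
import HarnessLib

/-!
# `ZagierDilogarithmConjecture` (stmt-KontsevichZagierPeriods-10550) — line
`kummer-clausen-linearisation` (reshape c2, "Galois descent"), stub `stub_cyclotomicPoints`

**Signed-permutation symmetry for cyclotomic points.** Let `ζ = exp(2πi/N)` (`N ≥ 1`) and let
`zᵢ = Σₘ qᵢₘ ζᵐ` (`qᵢₘ ∈ ℚ`, `m < N`) be points of `ℚ(ζ)` with integer coefficients `nᵢ`. Suppose the
configuration is ORBIT-SYMMETRIC: for every `j` coprime to `N` the Galois-twisted family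
`(Σₘ qᵢₘ ζ^{jm})ᵢ` is a coefficient-preserving permutation of `(zᵢ)ᵢ` or of `(z̄ᵢ)ᵢ`. Then for every
`ℚ`-algebra map `σ : ℚ̄ → ℂ` (`ℚ̄ = algebraicClosure ℚ ℂ ⊆ ℂ`) and the lifts `wᵢ, w'ᵢ ∈ ℚ̄` of `zᵢ, z̄ᵢ`,
each of the families `(σ wᵢ)ᵢ`, `(σ w'ᵢ)ᵢ` is all-real, or a coefficient-preserving permutation of `(zᵢ)`,
or of `(z̄ᵢ)` — the SIGNED-PERMUTATION property consumed by `stub_signedPermutation`/`stub_selfSimilar`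
(we only ever produce the last two alternatives).

Proof. `ζ` is a primitive `N`-th root of unity (`Complex.isPrimitiveRoot_exp`), algebraic (root of
`X ^ N − 1`), so it lifts to `Z ∈ ℚ̄`, again a primitive `N`-th root; `σ Z` is a primitive `N`-th root in
`ℂ`, hence `σ Z = ζ ^ j` with `j` coprime to `N` (`IsPrimitiveRoot.isPrimitiveRoot_iff`). In coordinates
`wᵢ = Σₘ qᵢₘ Zᵐ`, so `σ wᵢ = Σₘ qᵢₘ ζ^{jm}` and orbit symmetry at `j` gives the claim for the first family.
Since `ζ̄ = ζ⁻¹ = ζ^{N−1}`, `z̄ᵢ = Σₘ qᵢₘ ζ^{(N−1)m}`, `w'ᵢ = Σₘ qᵢₘ Z^{(N−1)m}` and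
`σ w'ᵢ = Σₘ qᵢₘ ζ^{(j(N−1))m}`; orbit symmetry at `j(N−1)` (coprime to `N`) gives the claim for the second
family. Mathlib only; sorry-free; axioms ⊆ {propext, Classical.choice, Quot.sound}.
-/

noncomputable section

open scoped BigOperators ComplexConjugate
open Literature.NumberTheory.Transcendental

namespace Summit.KontsevichZagierPeriods.HyperbolicBloch.ZagierDilogarithmGaloisDescent

/-- `N - 1` is coprime to `N` for `N ≥ 1` (for `N = 1` this reads `gcd 0 1 = 1`). [folklore] -/
theorem cyclo_coprime_sub_one {N : ℕ} (hN : 0 < N) : (N - 1).Coprime N :=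
  (Nat.coprime_self_sub_left (Nat.succ_le_of_lt hN)).2 (Nat.coprime_one_left N)

/-- The complex conjugate of a primitive `N`-th root of unity `ζ ∈ ℂ` (`N ≥ 1`) is `ζ ^ (N - 1)`:
`ζ̄ = ζ⁻¹` as `‖ζ‖ = 1`, and `ζ · ζ ^ (N - 1) = ζ ^ N = 1`. [folklore] -/
theorem cyclo_conj_eq_pow {ζ : ℂ} {N : ℕ} (hζ : IsPrimitiveRoot ζ N) (hN : 0 < N) :
    conj ζ = ζ ^ (N - 1) := by
  rw [← Complex.inv_eq_conj (hζ.norm'_eq_one hN.ne')]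
  exact inv_eq_of_mul_eq_one_right (by rw [mul_pow_sub_one hN.ne', hζ.pow_eq_one])

/-- A `ℚ`-linear combination `Σₘ qₘ ζ ^ (e m)` of powers of a primitive root `ζ`, conjugated:
`conj (Σₘ qₘ ζ ^ (e m)) = Σₘ qₘ ζ ^ ((N - 1) * e m)`. [folklore] -/
theorem cyclo_conj_sum {ζ : ℂ} {N : ℕ} (hζ : IsPrimitiveRoot ζ N) (hN : 0 < N) {ι : Type*}
    (s : Finset ι) (q : ι → ℚ) (e : ι → ℕ) :
    conj (∑ m ∈ s, (q m : ℂ) * ζ ^ e m) = ∑ m ∈ s, (q m : ℂ) * ζ ^ ((N - 1) * e m) := by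
  rw [map_sum]
  refine Finset.sum_congr rfl fun m _ => ?_
  rw [map_mul, map_ratCast, map_pow, cyclo_conj_eq_pow hζ hN, ← pow_mul]

/-- Evaluating a `ℚ`-algebra map `σ : ℚ̄ → ℂ` on a `ℚ`-linear combination of powers of `Z ∈ ℚ̄` with
`σ Z = ζ ^ j`: `σ (Σₘ qₘ Z ^ (e m)) = Σₘ qₘ ζ ^ (j * e m)`. [folklore] -/
theorem cyclo_map_sum (σ : ↥(algebraicClosure ℚ ℂ) →ₐ[ℚ] ℂ) {Z : ↥(algebraicClosure ℚ ℂ)} {ζ : ℂ}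
    {j : ℕ} (hσZ : σ Z = ζ ^ j) {ι : Type*} (s : Finset ι) (q : ι → ℚ) (e : ι → ℕ) :
    σ (∑ m ∈ s, ((q m : ℚ) : ↥(algebraicClosure ℚ ℂ)) * Z ^ e m) =
      ∑ m ∈ s, (q m : ℂ) * ζ ^ (j * e m) := by
  rw [map_sum]
  refine Finset.sum_congr rfl fun m _ => ?_
  rw [map_mul, map_ratCast, map_pow, hσZ, ← pow_mul]

/-- **Stub `stub_cyclotomicPoints` (signed-permutation symmetry for orbit-symmetric cyclotomic
configurations).** For `ζ = exp(2πi/N)`, points `zᵢ = Σₘ qᵢₘ ζᵐ ∈ ℚ(ζ)` with coefficients `nᵢ ∈ ℤ` such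
that for every `j` coprime to `N` the twisted family `(Σₘ qᵢₘ ζ^{jm})ᵢ` is a coefficient-preserving
permutation of `(zᵢ)` or of `(z̄ᵢ)`, and every `ℚ`-algebra map `σ : ℚ̄ → ℂ` with lifts `wᵢ, w'ᵢ ∈ ℚ̄` of
`zᵢ, z̄ᵢ`: each family `(σ wᵢ)ᵢ`, `(σ w'ᵢ)ᵢ` is all-real, or a coefficient-preserving permutation of `(zᵢ)`,
or of `(z̄ᵢ)`. (`σ` sends the lift of `ζ` to `ζ ^ j`, `j` coprime to `N`; apply the hypothesis at `j` and
at `j (N - 1)`.) [folklore] -/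
theorem stub_cyclotomicPoints :
    ∀ (N : ℕ), 0 < N → ∀ (k : ℕ) (z : Fin k → ℂ) (n : Fin k → ℤ) (q : Fin k → Fin N → ℚ),
      (∀ i, z i = ∑ m : Fin N, (q i m : ℂ) *
        Complex.exp (2 * Real.pi * Complex.I / N) ^ (m : ℕ)) →
      (∀ j : ℕ, j.Coprime N →
        (∃ π : Equiv.Perm (Fin k), (∀ i, n (π i) = n i) ∧ ∀ i,
            (∑ m : Fin N, (q i m : ℂ) * Complex.exp (2 * Real.pi * Complex.I / N) ^ (j * (m : ℕ))) =
              z (π i)) ∨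
        (∃ π : Equiv.Perm (Fin k), (∀ i, n (π i) = n i) ∧ ∀ i,
            (∑ m : Fin N, (q i m : ℂ) * Complex.exp (2 * Real.pi * Complex.I / N) ^ (j * (m : ℕ))) =
              conj (z (π i)))) →
        ∀ (σ : ↥(algebraicClosure ℚ ℂ) →ₐ[ℚ] ℂ) (w w' : Fin k → ↥(algebraicClosure ℚ ℂ)),
          (∀ i, (w i : ℂ) = z i) → (∀ i, (w' i : ℂ) = conj (z i)) →
          ((∀ i, (σ (w i)).im = 0) ∨
            (∃ π : Equiv.Perm (Fin k), (∀ i, n (π i) = n i) ∧ ∀ i, σ (w i) = z (π i)) ∨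
            (∃ π : Equiv.Perm (Fin k), (∀ i, n (π i) = n i) ∧ ∀ i, σ (w i) = conj (z (π i)))) ∧
          ((∀ i, (σ (w' i)).im = 0) ∨
            (∃ π : Equiv.Perm (Fin k), (∀ i, n (π i) = n i) ∧ ∀ i, σ (w' i) = z (π i)) ∨
            (∃ π : Equiv.Perm (Fin k), (∀ i, n (π i) = n i) ∧ ∀ i, σ (w' i) = conj (z (π i)))) := by
  intro N hN k z n q hz hH σ w w' hw hw'
  haveI : NeZero N := ⟨hN.ne'⟩
  -- `ζ = exp (2πi/N)` is a primitive `N`-th root of unity; abstract it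
  have hζ : IsPrimitiveRoot (Complex.exp (2 * Real.pi * Complex.I / N)) N :=
    Complex.isPrimitiveRoot_exp N hN.ne'
  generalize Complex.exp (2 * Real.pi * Complex.I / N) = ζ at hz hH hζ
  -- `ζ` is algebraic; its lift `Z ∈ ℚ̄` is a primitive `N`-th root, and `σ Z = ζ ^ j`, `j` coprime to `N`
  have hζa : IsAlgebraic ℚ ζ := by
    refine ⟨Polynomial.X ^ N - Polynomial.C 1, Polynomial.X_pow_sub_C_ne_zero hN 1, ?_⟩
    simp [hζ.pow_eq_one]
  obtain ⟨Z, hZ⟩ : ∃ Z : ↥(algebraicClosure ℚ ℂ), (Z : ℂ) = ζ :=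
    ⟨⟨ζ, mem_algebraicClosure_iff.2 hζa⟩, rfl⟩
  have hZp : IsPrimitiveRoot Z N := by
    refine IsPrimitiveRoot.of_map_of_injective (f := (algebraicClosure ℚ ℂ).val) ?_
      (algebraicClosure ℚ ℂ).val.toRingHom.injective
    show IsPrimitiveRoot (Z : ℂ) N
    rw [hZ]
    exact hζ
  obtain ⟨j, -, hj, hσZ⟩ := hζ.isPrimitiveRoot_iff.1 (hZp.map_of_injective σ.toRingHom.injective)
  -- the lifts in coordinates: `wᵢ = Σₘ qᵢₘ Zᵐ`, `w'ᵢ = Σₘ qᵢₘ Z^{(N-1)m}`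
  have hwZ : ∀ i, w i = ∑ m : Fin N, ((q i m : ℚ) : ↥(algebraicClosure ℚ ℂ)) * Z ^ (m : ℕ) :=
    fun i => Subtype.ext (by
      push_cast
      rw [hw i, hz i, hZ])
  have hw'Z : ∀ i, w' i =
      ∑ m : Fin N, ((q i m : ℚ) : ↥(algebraicClosure ℚ ℂ)) * Z ^ ((N - 1) * (m : ℕ)) :=
    fun i => Subtype.ext (by
      push_cast
      rw [hw' i, hz i, cyclo_conj_sum hζ hN, hZ])
  -- hence `σ wᵢ = Σₘ qᵢₘ ζ^{jm}` and `σ w'ᵢ = Σₘ qᵢₘ ζ^{(j(N-1))m}`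
  have hσw : ∀ i, σ (w i) = ∑ m : Fin N, (q i m : ℂ) * ζ ^ (j * (m : ℕ)) := fun i => by
    rw [hwZ i, cyclo_map_sum σ hσZ.symm]
  have hσw' : ∀ i, σ (w' i) = ∑ m : Fin N, (q i m : ℂ) * ζ ^ (j * (N - 1) * (m : ℕ)) := fun i => by
    rw [hw'Z i, cyclo_map_sum σ hσZ.symm]
    simp only [mul_assoc]
  have hj' : (j * (N - 1)).Coprime N := hj.mul_left (cyclo_coprime_sub_one hN)
  -- orbit symmetry at `j` and at `j (N - 1)`
  refine ⟨Or.inr ?_, Or.inr ?_⟩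
  · rcases hH j hj with ⟨π, hπn, hπ⟩ | ⟨π, hπn, hπ⟩
    · exact Or.inl ⟨π, hπn, fun i => (hσw i).trans (hπ i)⟩
    · exact Or.inr ⟨π, hπn, fun i => (hσw i).trans (hπ i)⟩
  · rcases hH (j * (N - 1)) hj' with ⟨π, hπn, hπ⟩ | ⟨π, hπn, hπ⟩
    · exact Or.inl ⟨π, hπn, fun i => (hσw' i).trans (hπ i)⟩
    · exact Or.inr ⟨π, hπn, fun i => (hσw' i).trans (hπ i)⟩

end Summit.KontsevichZagierPeriods.HyperbolicBloch.ZagierDilogarithmGaloisDescent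

end
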